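/-
Copyright (c) 2026 the pub-hodgecm-mathlib formalisation cell (harness21).  Prover seat hodgecm-mathlib-K2E3-p20 (g4), HCML Track B «K2-LIT» (build stream 29),
h413 = `stmt-HodgeConjecture-24833`, line `K2_E3_EllipticInputs`, unit U12 «Characters», socket #11 road (11-SC), letter (SC-an), END-GAME MAP v3 brick (M5a) —
PLACE EDITION of ★ p856869 `K2E3SplitTorusOrbitalBoundRankOne` ((SC-an) line lead K2E3-p14 (g3) RULINGS #2 (i), `K2/STATUS.md` 2026-09-04T02:41:02Z): the two
structural binders `hKB` (Iwasawa `U = K₁·B`) and `hunimod` (unimodularity) of the model head DISCHARGED at `K = L_w`, `σ = σ_w`, for a place `w ∣ v` fixed by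
complex conjugation.  2026-09-04.
-/
import Summits.HodgeConjecture.HodgeConjecture.Theorems.K2E3SplitTorusOrbitalBoundRankOne   -- ★ p856869 (this seat): the model head `exists_const_lintegral_descConj_torusU_le` (Thm 14 on the split torus)
import Summits.HodgeConjecture.HodgeConjecture.Theorems.K2E3SupercuspModelFrameAtPlace      -- ★ p856783 [M2a] FILE A (K2E3-p14): `placeForm_qsForm_eq_over`, `isMulRightInvariant_of_isHaarMeasure_of_eq_over`, `secondCountableTopology_…`∕`locallyCompactSpace_unitaryGroupOfForm_adicCompletion`; brings ★ `localNonsplitEquiv`, ★ `secondCountableTopology_adicCompletion`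
import Literature.NumberTheory.Automorphic.UnitaryGroupCMLocalIwasawa                      -- ★ `exists_mem_cmLocalIntegralLevel_mul_borel` (`U(Φ₃)(L⁺_v) = K_v · B`); brings ★ `isCompact_isOpen_cmLocalIntegralLevel`
import HarnessLib

/-!
# h413 ∕ Track B «K2-LIT», (SC-an) line, brick (M5a), PLACE EDITION: THEOREM 14 ON THE SPLIT TORUS OF `U(σ_w, Φ₃)(L_w)` WITH THE IWASAWA AND UNIMODULARITY BINDERS
# DISCHARGED — `U(σ_w, Φ₃)(L_w) = K₁ · B` for a compact subgroup `K₁` (the one-place image of `U(Φ₃)(𝒪_v)`), and `∫_{U⧸T} Θ(ẏ t ẏ⁻¹) dμQ ≤ C·‖Θ‖_∞·J(t)` hypothesis-free in the frame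
# (Bruhat–Tits 1972 (4.4.3); Harish-Chandra 1970, Part VI §8 Thm 14; Rogawski 1990, §4.5, §4.9, §4.13)

Cell `pub/hodgecm-mathlib`, crux H413 = `stmt-HodgeConjecture-24833`, route of record `HCCMUnconditional`; chair K2-lead (g0), dealer K2E3-plan (g2), (SC-an) line lead
K2E3-p14 (g3).  THEOREMS ONLY (no `def`, no `instance`, no `notation`, no named-fact hypothesis, no `sorry`); lane `--supports stmt-HodgeConjecture-24833 --as helper`,
count-neutral.  RULING #2 (i): «keep `hKB` (Iwasawa `U = K₁·B`) and `hunimod` as HYPOTHESES in the model head; discharge BOTH at `K = L_w` in your own §: `hunimod` := ★ [M2a]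
FILE A `isMulRightInvariant_of_isHaarMeasure_of_eq_over`; `hKB` := ★ `exists_mem_cmLocalIntegralLevel_mul_borel` along ★ `localNonsplitEquiv` with `K₁ = Ω 0`».

THE MATHEMATICS.  At a finite place `v` of `L⁺` with a place `w ∣ v` of the CM field `L` fixed by complex conjugation (`v` non-split), the one-place model
`e₀ : U(Φ₃)(L⁺_v) ≃ₜ* U(σ_w, Φ₃)(L_w)` (★ `localNonsplitEquiv`; on matrices: the `w`-component, `rfl`) carries the Iwasawa decomposition `U(Φ₃)(L⁺_v) = K_v · B` of
[BruhatTits1972, (4.4.3)] (★ `exists_mem_cmLocalIntegralLevel_mul_borel`, `K_v = U(Φ₃)(𝒪_v)` compact open ★ `isCompact_isOpen_cmLocalIntegralLevel`) to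
**`U(σ_w, Φ₃)(L_w) = K₁ · B_w`, `K₁ := e₀(K_v)`** (compact; `= U(σ_w,Φ₃)(L_w) ∩ GL₃(𝒪_w)` by ★ `mem_localIntegralLevel_iff_of_smul_eq`, not needed here): upper-triangularity is read
entrywise, so `e₀(B) ⊆ B_w` (Mathlib `Matrix.BlockTriangular.map`).  Together with ★ [M2a] (c) (every Haar measure on `U(σ_w, Φ₃)(L_w)` is right invariant) this discharges the
two binders of ★ p856869 `exists_const_lintegral_descConj_torusU_le`, giving Harish-Chandra's Theorem 14 on the split torus AT THE PLACE with no structural hypothesis left: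
**`∃ C, ∀ Θ (measurable, = 0 off S, ≤ M), ∀ t = diag d` regular, `∫⁻_{U⧸T} Θ(ẏ t ẏ⁻¹) dμQ ≤ C · M · J(t)`**, `J(t) = (‖a−1‖·χ⁻(b−1))⁻¹` (★ Lemma 22's module; its size is
★ p856900 `K2E3SplitTorusTwistModuleBound`).

* §1 **`exists_isCompact_subgroup_mul_borelU_of_eq_over`** — `∃ K₁ ≤ U(σ_w, Φ₃)(L_w)` compact with `∀ g, ∃ k ∈ K₁, ∃ b ∈ B, g = k b` (the `hKB` binder).
* §2 **`exists_const_lintegral_descConj_torusU_le_place`** — ★ p856869's head at `K = L_w`, `σ = σ_w` with `hKB`, `hunimod`, `hσ`, `hσc`, `h2` and the countability ∕ local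
  compactness instances ALL discharged (remaining binders: the Borel structures, the invariant measure `μQ` on `U ⧸ T`, the compact `S`).

HONEST LABEL.  HC_CM is proved only modulo the 7 printed citations (2 remaining named inputs: hLiu418 = `stmt-HodgeConjecture-24832`, h413 = `stmt-HodgeConjecture-24833`)
until rung 0 closes; count-neutral helper (place-level plumbing for the (M5e)∕(M5h) assembly; nothing printed is asserted as a fact).

## References
* [BruhatTits1972] F. Bruhat, J. Tits, *Groupes réductifs sur un corps local I*, Publ. Math. IHÉS 41 (1972), (4.4.3) (Iwasawa decomposition `G = B K`).
* [HarishChandra1970] Harish-Chandra (notes by G. van Dijk), *Harmonic Analysis on Reductive p-adic Groups*, LNM 162 (1970), Part VI §8 Theorem 14 p. 60; Part VII §3 p. 72.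
* [Rogawski1990] J. D. Rogawski, *Automorphic Representations of Unitary Groups in Three Variables*, Ann. of Math. Stud. 123 (1990), §4.5 p. 45; §4.9 p. 54; §4.13 p. 70.
* [PlatonovRapinchuk1994] V. Platonov, A. Rapinchuk, *Algebraic Groups and Number Theory* (1994), §3.5, §5.1.
-/

set_option autoImplicit false
set_option linter.dupNamespace false  -- the mandated namespace repeats the single-problem summit's segment (`HodgeConjecture.HodgeConjecture`)

noncomputable section

open NumberField IsDedekindDomain MeasureTheory Measure Set
open scoped ENNReal NNReal Matrix MatrixGroups
open Literature.MeasureTheory.Group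
open Literature.NumberTheory.Automorphic Literature.NumberTheory.Automorphic.UnitaryGroup Literature.NumberTheory.Rogawski1990
open Summit.HodgeConjecture.HodgeConjecture.Cruxes.H413

namespace Summit.HodgeConjecture.HodgeConjecture.Cruxes.H413.K2E3SplitTorusOrbitalBoundPlace

variable (L : Type) [Field L] [NumberField L] [IsCMField L] {v : HeightOneSpectrum (𝓞 ↥(maximalRealSubfield L))}
  (w : PlacesOver L v) (hw : IsCMField.complexConj L • w.1 = w.1)

/-! ## §1 The Iwasawa decomposition of the one-place model: `U(σ_w, Φ₃)(L_w) = K₁ · B` -/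

/-- **`U(σ_w, Φ₃)(L_w) = K₁ · B` FOR A COMPACT SUBGROUP `K₁`** (the `hKB` binder of ★ `K2E3SplitTorusOrbitalBoundRankOne.exists_const_lintegral_descConj_torusU_le` at the place):
`K₁` is the image under the one-place model ★ `localNonsplitEquiv` of the integral level `U(Φ₃)(𝒪_v)` (compact open, ★ `isCompact_isOpen_cmLocalIntegralLevel`), and the
decomposition is ★ `exists_mem_cmLocalIntegralLevel_mul_borel` (`U(Φ₃)(L⁺_v) = K_v · B`) read at `w` (upper triangular ↦ upper triangular, Mathlib `Matrix.BlockTriangular.map`).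
[cite: BruhatTits1972, (4.4.3)] [cite: Rogawski1990, §4.5 p. 45] [cite: PlatonovRapinchuk1994, §5.1] -/
theorem exists_isCompact_subgroup_mul_borelU_of_eq_over {J : Matrix (Fin 3) (Fin 3) (w.1.adicCompletion L)}
    (hJ : J = (StdForm.antidiagonal 3).over (w.1.adicCompletion L)) :
    ∃ K₁ : Subgroup ↥(unitaryGroupOfForm (galAdicCompletionMap (L := L) (IsCMField.complexConj L) hw) J),
      IsCompact (K₁ : Set ↥(unitaryGroupOfForm (galAdicCompletionMap (L := L) (IsCMField.complexConj L) hw) J)) ∧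
      ∀ g : ↥(unitaryGroupOfForm (galAdicCompletionMap (L := L) (IsCMField.complexConj L) hw) J),
        ∃ k ∈ K₁, ∃ b ∈ borelU (galAdicCompletionMap (L := L) (IsCMField.complexConj L) hw) J, g = k * b := by
  obtain rfl : J = placeForm (qsForm L) w.1 := hJ.trans (K2E3SupercuspModelFrameAtPlace.placeForm_qsForm_eq_over L w).symm
  set e₀ := localNonsplitEquiv (IsCMField.complexConj L) (qsForm L) (IsCMField.complexConj_ne_one L) w hw with he₀
  refine ⟨(cmLocalIntegralLevel L 3 (qsForm L) v).map e₀.toMonoidHom, ?_, fun g => ?_⟩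
  · rw [Subgroup.coe_map]
    exact (isCompact_isOpen_cmLocalIntegralLevel L 3 (qsForm L) v).1.image e₀.continuous
  · obtain ⟨κ, hκ, h, hg⟩ := exists_mem_cmLocalIntegralLevel_mul_borel L 3 v (e₀.symm g)
    -- the Borel element `h` viewed in the ambient group `U(Φ₃)(L⁺_v)` (= the domain of `e₀`, `rfl`)
    set h' : ↥(unitaryGroupOfForm (conjLocal L (IsCMField.complexConj L) v) (cmLocalForm L 3 v)) :=
      (h : ↥(unitaryGroupOfForm (conjLocal L (IsCMField.complexConj L) v) (cmLocalForm L 3 v))) with hh'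
    have hP : h' ∈ borelU (conjLocal L (IsCMField.complexConj L) v) (cmLocalForm L 3 v) := h.2
    refine ⟨e₀ κ, Subgroup.mem_map_of_mem (K := cmLocalIntegralLevel L 3 (qsForm L) v) e₀.toMonoidHom hκ, e₀ h', ?_, ?_⟩
    · -- `e₀ h` is upper triangular: its matrix is the `w`-component of the (upper triangular) matrix of `h` (★ `localNonsplitEquiv` is entrywise `rfl`)
      have hh := (mem_borelU_iff h').1 hP
      rw [mem_borelU_iff]
      exact hh.map (Pi.evalRingHom (fun w' : PlacesOver L v => w'.1.adicCompletion L) w)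
    · have h1 : e₀.symm g = κ * h' := hg
      calc g = e₀ (e₀.symm g) := (e₀.apply_symm_apply g).symm
        _ = e₀ κ * e₀ h' := by rw [h1]; exact map_mul e₀ κ h'

/-! ## §2 Theorem 14 on the split torus at the place, structural binders discharged -/

/-- **HARISH-CHANDRA'S THEOREM 14 ON THE SPLIT TORUS OF `U(σ_w, Φ₃)(L_w)`, HYPOTHESIS-FREE IN THE FRAME**: for every `U`-invariant measure `μQ` on `U ⧸ T` finite on compacta and
every compact `S ⊆ U` there is ONE `C : ℝ≥0` with `∫⁻_{U⧸T} Θ(ẏ t ẏ⁻¹) dμQ ≤ C · M · (‖a−1‖_{L_w} · χ⁻(b−1))⁻¹` for every measurable `Θ : U → [0,∞]` vanishing off `S` and bounded by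
`M`, and every regular diagonal `t = diag d` (`a − 1 = d₀⁻¹d₁ − 1`, `b − 1 = d₀⁻¹d₂ − 1` units) — ★ p856869's model head with `hKB` (§1), `hunimod` (★ [M2a] (c)), `hσ` (★
`galAdicCompletionMap_galAdicCompletionMap_of_smul_eq`), `hσc` (★ `continuous_galAdicCompletionMap`), `h2` (characteristic `0`) and the countability ∕ local-compactness instances
(★ [M2a] §3, ★ `secondCountableTopology_adicCompletion`) ALL discharged.
[cite: HarishChandra1970, Part VI §8 Theorem 14 p. 60; Part VII §3 p. 72] [cite: Rogawski1990, §4.13 Lemma 4.13.1 (a) p. 64, p. 70; §4.9 p. 54] [cite: BruhatTits1972, (4.4.3)] -/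
theorem exists_const_lintegral_descConj_torusU_le_place
    [MeasurableSpace (w.1.adicCompletion L)] [BorelSpace (w.1.adicCompletion L)]
    {J : Matrix (Fin 3) (Fin 3) (w.1.adicCompletion L)} (hJ : J = (StdForm.antidiagonal 3).over (w.1.adicCompletion L))
    [MeasurableSpace ↥(unitaryGroupOfForm (galAdicCompletionMap (L := L) (IsCMField.complexConj L) hw) J)]
    [BorelSpace ↥(unitaryGroupOfForm (galAdicCompletionMap (L := L) (IsCMField.complexConj L) hw) J)]
    [MeasurableSpace (↥(unitaryGroupOfForm (galAdicCompletionMap (L := L) (IsCMField.complexConj L) hw) J) ⧸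
      torusU (galAdicCompletionMap (L := L) (IsCMField.complexConj L) hw) J)]
    [BorelSpace (↥(unitaryGroupOfForm (galAdicCompletionMap (L := L) (IsCMField.complexConj L) hw) J) ⧸
      torusU (galAdicCompletionMap (L := L) (IsCMField.complexConj L) hw) J)]
    (μQ : Measure (↥(unitaryGroupOfForm (galAdicCompletionMap (L := L) (IsCMField.complexConj L) hw) J) ⧸
      torusU (galAdicCompletionMap (L := L) (IsCMField.complexConj L) hw) J))
    [SMulInvariantMeasure ↥(unitaryGroupOfForm (galAdicCompletionMap (L := L) (IsCMField.complexConj L) hw) J)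
      (↥(unitaryGroupOfForm (galAdicCompletionMap (L := L) (IsCMField.complexConj L) hw) J) ⧸
        torusU (galAdicCompletionMap (L := L) (IsCMField.complexConj L) hw) J) μQ]
    [IsFiniteMeasureOnCompacts μQ]
    {S : Set ↥(unitaryGroupOfForm (galAdicCompletionMap (L := L) (IsCMField.complexConj L) hw) J)} (hS : IsCompact S) :
    ∃ C : ℝ≥0, ∀ (Θ : ↥(unitaryGroupOfForm (galAdicCompletionMap (L := L) (IsCMField.complexConj L) hw) J) → ℝ≥0∞), Measurable Θ →
      (∀ g, Θ g ≠ 0 → g ∈ S) → ∀ (M : ℝ≥0∞), (∀ g, Θ g ≤ M) →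
      ∀ (t : ↥(torusU (galAdicCompletionMap (L := L) (IsCMField.complexConj L) hw) J))
        (ht : ∀ a ∈ torusU (galAdicCompletionMap (L := L) (IsCMField.complexConj L) hw) J,
          a * (t : ↥(unitaryGroupOfForm (galAdicCompletionMap (L := L) (IsCMField.complexConj L) hw) J)) =
            (t : ↥(unitaryGroupOfForm (galAdicCompletionMap (L := L) (IsCMField.complexConj L) hw) J)) * a)
        (d : Fin 3 → (w.1.adicCompletion L)ˣ)
        (hd : glDiagonal 3 (w.1.adicCompletion L) d =
          ((t : ↥(unitaryGroupOfForm (galAdicCompletionMap (L := L) (IsCMField.complexConj L) hw) J)) : GL (Fin 3) (w.1.adicCompletion L)))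
        (ha : IsUnit ((((d 0)⁻¹ * d 1 : (w.1.adicCompletion L)ˣ) : w.1.adicCompletion L) - 1))
        (hb : IsUnit ((((d 0)⁻¹ * d 2 : (w.1.adicCompletion L)ˣ) : w.1.adicCompletion L) - 1)),
        ∫⁻ q, descConj (t : ↥(unitaryGroupOfForm (galAdicCompletionMap (L := L) (IsCMField.complexConj L) hw) J))
            (torusU (galAdicCompletionMap (L := L) (IsCMField.complexConj L) hw) J) ht Θ q ∂μQ ≤
          C * M * (((distribHaarChar (w.1.adicCompletion L) ha.unit)⁻¹ *
            (HeisRing.skewModulus (galAdicCompletionMap (L := L) (IsCMField.complexConj L) hw) (continuous_galAdicCompletionMap L (IsCMField.complexConj L) hw)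
              hb.unit (HeisRing.map_unit_torusCentralScalar_sub_one (galAdicCompletionMap (L := L) (IsCMField.complexConj L) hw) hJ t hd hb))⁻¹ : ℝ≥0) : ℝ≥0∞) := by
  haveI : SecondCountableTopology (w.1.adicCompletion L) := secondCountableTopology_adicCompletion L w.1
  haveI : SecondCountableTopology ↥(unitaryGroupOfForm (galAdicCompletionMap (L := L) (IsCMField.complexConj L) hw) J) :=
    K2E3SupercuspModelFrameAtPlace.secondCountableTopology_unitaryGroupOfForm_adicCompletion L w _ J
  haveI : LocallyCompactSpace ↥(unitaryGroupOfForm (galAdicCompletionMap (L := L) (IsCMField.complexConj L) hw) J) :=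
    K2E3SupercuspModelFrameAtPlace.locallyCompactSpace_unitaryGroupOfForm_adicCompletion L w hw J
  haveI : CharZero (w.1.adicCompletion L) := charZero_of_injective_algebraMap (algebraMap L (w.1.adicCompletion L)).injective
  obtain ⟨K₁, hK₁, hKB⟩ := exists_isCompact_subgroup_mul_borelU_of_eq_over L w hw hJ
  exact K2E3SplitTorusOrbitalBoundRankOne.exists_const_lintegral_descConj_torusU_le (galAdicCompletionMap (L := L) (IsCMField.complexConj L) hw)
    (galAdicCompletionMap_galAdicCompletionMap_of_smul_eq (IsCMField.complexConj L) w (IsCMField.complexConj_ne_one L) hw)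
    (continuous_galAdicCompletionMap L (IsCMField.complexConj L) hw) two_ne_zero hJ
    (fun ν _ => K2E3SupercuspModelFrameAtPlace.isMulRightInvariant_of_isHaarMeasure_of_eq_over L w hw hJ ν) hK₁ hKB μQ hS

end Summit.HodgeConjecture.HodgeConjecture.Cruxes.H413.K2E3SplitTorusOrbitalBoundPlace

end
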